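import Literature.NumberTheory.EllipticCurves.ModularPolynomialIntegral
import HarnessLib

/-!
# The modular equation `Φ_p(X, Y)` has degree `≤ p + 1` in `Y`

Everything in this file is **proved**; there are no new definitions.  For a prime `p` the tree's
modular equation `Φ_p(X, Y) = Σ_m P_m(Y) X^m` (`modularPolynomial p`, Cox, *Primes of the form
x² + ny²*, §11.B (11.14); `P_m = modularPolynomialCoeff p m`) was constructed with the crude bound
`deg P_m ≤ p(p+1)` (the weight bound of the auxiliary modular forms).  Classically
`deg_Y Φ_p = p + 1` (Cox, Thm. 11.18 (iii): `Φ_p(X, Y) = Φ_p(Y, X)`, and `deg_X Φ_p = p + 1`).  We prove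
the inequality

* `natDegree_modularPolynomialCoeff_le_succ : deg P_m ≤ p + 1` for every `m`, and
* `natDegree_coeff_intModularPolynomial_le : deg_Y` of the coefficients of the integer model
  `intModularPolynomial p` (`ModularPolynomialIntegral.lean`) is `≤ p + 1`,

directly from the formal identity of `ModularPolynomialKronecker.lean`,
`X^{p(N−p−1)} · 𝒫_m = Σ_{i ≤ N} π_{m,i} Wⁱ X^{p(N−i)}` in `ℂ⟦X⟧` (`X_pow_mul_coeff_formalPhi_map`,
`N = p(p+1)`, `W = (q·j)(X^p)` a series with constant term `1`): the left-hand side vanishes to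
order `≥ p(N − p − 1)`, while if `d = deg P_m > p + 1` the right-hand side has the nonzero
coefficient `π_{m,d}` in degree `p(N − d) < p(N − p − 1)` (the terms `i < d` only start in degree
`p(N − i) > p(N − d)`).  This is the order-of-pole count `ord_∞ P_m(j) ≤ p + 1` of the classical
proof, read on `q`-expansions.  It is the input "(H1), degree part" of
`Literature.NumberTheory.Transcendental.mahlerManinPadic_of_modularPolynomial`.

## References

* D. A. Cox, *Primes of the form x² + ny²*, 2nd ed., Wiley 2013, §11.B (11.14)–(11.15),
  §11.C Thm. 11.18 (iii). [Cox2013]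
* S. Lang, *Elliptic Functions*, 2nd ed., GTM 112, Springer 1987, Ch. 5 §2, Thm. 3.
-/

noncomputable section

open Polynomial PowerSeries

namespace Literature.NumberTheory.EllipticCurves

variable (p : ℕ) [Fact p.Prime]

/-- **`deg_Y Φ_p ≤ p + 1`**: every coefficient polynomial `P_m(Y)` of the modular equation
`Φ_p(X, Y) = Σ_m P_m(Y) X^m` has degree `≤ p + 1` (Cox Thm. 11.18 (iii) gives `deg_Y Φ_p = p + 1` by
symmetry; here from the orders of vanishing in `X^{p(N−p−1)} 𝒫_m = Σ π_{m,i} Wⁱ X^{p(N−i)}`).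
[cite: Cox2013, §11.C Thm. 11.18(iii)] -/
theorem natDegree_modularPolynomialCoeff_le_succ (m : ℕ) :
    (modularPolynomialCoeff p m).natDegree ≤ p + 1 := by
  by_contra hlt
  rw [not_le] at hlt
  set P := modularPolynomialCoeff p m with hP
  set d := P.natDegree with hd
  set N := degBound p with hNdef
  have hdN : d ≤ N := natDegree_modularPolynomialCoeff_le_degBound p m
  have hp0 : 0 < p := (Fact.out : p.Prime).pos
  have hP0 : P ≠ 0 := by
    intro h
    rw [h, natDegree_zero] at hd
    omega
  -- compare the coefficients of `X^{p(N - d)}` in the formal identity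
  have key := congr_arg (PowerSeries.coeff (p * (N - d))) (X_pow_mul_coeff_formalPhi_map p m)
  -- left-hand side: zero, since `p(N - d) < p(N - p - 1)`
  have hL : PowerSeries.coeff (p * (N - d))
      (PowerSeries.X ^ (p * (N - (p + 1))) * ((formalPhi p).coeff m).map (cycEmb p)) = 0 := by
    rw [PowerSeries.coeff_X_pow_mul', if_neg]
    intro h
    have : N - (p + 1) ≤ N - d := Nat.le_of_mul_le_mul_left h hp0
    omega
  -- right-hand side: the single term `i = d` contributes `π_{m,d}`
  have hR : PowerSeries.coeff (p * (N - d))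
      (∑ i ∈ Finset.range (N + 1), PowerSeries.C (P.coeff i) *
        (PowerSeries.map (Int.castRingHom ℂ) (expand p (Fact.out : p.Prime).ne_zero formalXJ)) ^ i *
          PowerSeries.X ^ (p * (N - i))) = P.coeff d := by
    rw [map_sum, Finset.sum_eq_single d]
    · rw [PowerSeries.coeff_mul_X_pow', if_pos le_rfl, Nat.sub_self, PowerSeries.coeff_zero_eq_constantCoeff_apply,
        map_mul, map_pow, PowerSeries.constantCoeff_C, ← PowerSeries.coeff_zero_eq_constantCoeff_apply,
        PowerSeries.coeff_map, PowerSeries.coeff_zero_eq_constantCoeff_apply, constantCoeff_expand,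
        constantCoeff_formalXJ, map_one, one_pow, mul_one]
    · intro i hi hne
      rcases lt_or_gt_of_ne hne with hlt' | hgt
      · -- `i < d`: the term starts in degree `p(N - i) > p(N - d)`
        rw [PowerSeries.coeff_mul_X_pow', if_neg]
        intro h
        have : N - i ≤ N - d := Nat.le_of_mul_le_mul_left h hp0
        omega
      · -- `i > d`: `π_{m,i} = 0`
        rw [Polynomial.coeff_eq_zero_of_natDegree_lt hgt, map_zero, zero_mul, zero_mul, map_zero]
    · intro h
      exact absurd (Finset.mem_range.mpr (Nat.lt_succ_of_le hdN)) h
  rw [hL, ← hP, hR] at key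
  exact hP0 (Polynomial.leadingCoeff_eq_zero.mp (by rw [Polynomial.leadingCoeff, ← hd]; exact key.symm))

/-- The coefficients of the integer model `intModularPolynomial p` map to the `P_m`. [folklore] -/
theorem map_coeff_intModularPolynomial (m : ℕ) :
    ((intModularPolynomial p).coeff m).map (Int.castRingHom ℂ) = modularPolynomialCoeff p m := by
  rw [← coeff_modularPolynomial, ← map_intModularPolynomial, Polynomial.coeff_map, coe_mapRingHom]

/-- **`deg_Y` of the integer modular equation is `≤ p + 1`**: for every `m`, the coefficient of `X^m`
in `intModularPolynomial p ∈ ℤ[Y][X]` has degree `≤ p + 1` in `Y`. [cite: Cox2013, §11.C Thm. 11.18(iii)] -/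
theorem natDegree_coeff_intModularPolynomial_le (m : ℕ) :
    ((intModularPolynomial p).coeff m).natDegree ≤ p + 1 := by
  rw [← natDegree_map_eq_of_injective (RingHom.injective_int (Int.castRingHom ℂ))
    ((intModularPolynomial p).coeff m), map_coeff_intModularPolynomial]
  exact natDegree_modularPolynomialCoeff_le_succ p m

end Literature.NumberTheory.EllipticCurves

end
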